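import Mathlib.NumberTheory.Chebyshev
import Mathlib.NumberTheory.Primorial
import Mathlib.FieldTheory.Finite.Basic
import HarnessLib

/-!
# Number-theoretic facts behind Chinese remaindering in the counting hierarchy

Elementary facts (theorems only, all from Mathlib ingredients) used by the scaled-up
Hesse–Allender–Barrington arithmetic (JCSS 65 (2002), §4) in Bürgisser's proof that iterated
products are definable in `CH` (ECCC TR06-113, Thm. 3.7):

* **enough short primes** (`two_pow_le_mul_primeCounting`): `2ᵗ ≤ t · π(2ᵗ) + t + 1` — a crude
  Chebyshev bound in `ℕ`, from Mathlib's `Chebyshev.two_pow_le_mul_lcmUpto` (`2ⁿ ≤ (n+1) lcm(1..n)`) and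
  `lcm(1..n) = ∏_{p ≤ n} p^{⌊log_p n⌋} ≤ n^{π(n)}`; and `2^{π(n)} ≤ n#` (`two_pow_primeCounting_le_primorial`),
  so polynomially large prime bases have exponentially large products ("the prime number theorem
  guarantees that there are more than enough primes of that length", HAB §4);
* **Chinese remainder uniqueness** over a finite set of primes (`mod_prod_eq_of_forall_mod_eq`,
  `eq_of_forall_mod_prime_eq`);
* **generators and discrete logarithms** modulo a prime (HAB §4, Step 2: "the least `g` such that
  `gⁱ ≢ 1 (mod p)` for `0 < i < p - 1` … `gⁱ ≡ a` has a unique solution … the iterated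
  multiplication problem reduces to iterated addition by adding the discrete logs"):
  `exists_pow_mod_eq_of_forall_pow_ne_one` (the order test characterises generators: every unit
  is a power, i.e. discrete logarithms exist), `exists_generator_mod_prime`, `pow_mod_injOn`
  (uniqueness of the discrete logarithm), and the product formula `prod_mod_prime_eq_pow_sum_dlog`.

## References

* W. Hesse, E. Allender, D. A. M. Barrington, JCSS 65 (2002), §4.
* P. Bürgisser, ECCC TR06-113 (2006), proof of Thm. 3.7.
* Mathlib: `Chebyshev.two_pow_le_mul_lcmUpto`, `Nat.lcmUpto_eq_prod_pow_log`, `ZMod.card_units`,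
  `IsCyclic.exists_monoid_generator`.
-/

namespace Literature.Computability.Complexity

open Finset Nat

/-! ### Enough short primes -/

/-- `lcm(1, …, n) ≤ n^{π(n)}` (each prime power `p^{⌊log_p n⌋}` is at most `n`). [folklore] -/
theorem lcmUpto_le_pow_primeCounting (n : ℕ) : Nat.lcmUpto n ≤ n ^ primeCounting n := by
  rw [Nat.lcmUpto_eq_prod_pow_log, ← primesLE_card_eq_primeCounting, ← prod_const]
  refine prod_le_prod' fun p hp => ?_
  have hp' := mem_primesLE.1 hp
  rcases Nat.eq_zero_or_pos n with rfl | hn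
  · exact absurd (Nat.le_zero.1 hp'.1 ▸ hp'.2) Nat.not_prime_zero
  · exact Nat.pow_log_le_self p hn.ne'

/-- **A Chebyshev bound in `ℕ`**: `2ⁿ ≤ (n + 1) · n^{π(n)}`. [folklore] -/
theorem two_pow_le_mul_pow_primeCounting (n : ℕ) : 2 ^ n ≤ (n + 1) * n ^ primeCounting n :=
  (Chebyshev.two_pow_le_mul_lcmUpto n).trans (Nat.mul_le_mul_left _ (lcmUpto_le_pow_primeCounting n))

/-- **Enough short primes**: `2ᵗ ≤ t · π(2ᵗ) + t + 1`, i.e. there are at least `(2ᵗ - t - 1)/t`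
primes below `2ᵗ` ("the prime number theorem guarantees that there will be more than enough
primes of that length", HAB 2002, §4; here from `two_pow_le_mul_pow_primeCounting` at `n = 2ᵗ`). [cite: HesseAllenderBarrington2002, §4] -/
theorem two_pow_le_mul_primeCounting (t : ℕ) : 2 ^ t ≤ t * primeCounting (2 ^ t) + t + 1 := by
  have h := two_pow_le_mul_pow_primeCounting (2 ^ t)
  rw [← pow_mul] at h
  have h2 : (2 ^ t + 1) * 2 ^ (t * primeCounting (2 ^ t)) ≤ 2 ^ (t + 1) * 2 ^ (t * primeCounting (2 ^ t)) :=
    Nat.mul_le_mul_right _ (by rw [pow_succ]; have := Nat.one_le_two_pow (n := t); omega)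
  rw [← pow_add] at h2
  exact (Nat.pow_le_pow_iff_right (by norm_num)).1 (h.trans h2) |>.trans (by omega)

/-- `2^{π(n)} ≤ n#`: the primorial is at least `2` to the number of primes. [folklore] -/
theorem two_pow_primeCounting_le_primorial (n : ℕ) : 2 ^ primeCounting n ≤ primorial n := by
  rw [primorial, ← primesLE_card_eq_primeCounting, ← prod_const]
  exact prod_le_prod' fun p hp => (mem_primesLE.1 hp).2.two_le

/-! ### Chinese remainder uniqueness -/

/-- **Chinese remaindering, uniqueness**: numbers congruent modulo every prime of a finite set
of primes are congruent modulo their product. [folklore] -/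
theorem mod_prod_eq_of_forall_mod_eq {S : Finset ℕ} (hS : ∀ p ∈ S, p.Prime) {X Y : ℕ}
    (h : ∀ p ∈ S, X % p = Y % p) : X % (∏ p ∈ S, p) = Y % (∏ p ∈ S, p) := by
  classical
  induction S using Finset.induction_on with
  | empty => simp [Nat.mod_one]
  | insert q S hq ih =>
    rw [prod_insert hq]
    have hcop : Nat.Coprime q (∏ p ∈ S, p) :=
      Nat.Coprime.prod_right fun p hp => (Nat.coprime_primes (hS q (mem_insert_self q S))
        (hS p (mem_insert_of_mem hp))).2 (fun h' => hq (h' ▸ hp))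
    have h1 : X ≡ Y [MOD q] := h q (mem_insert_self q S)
    have h2 : X ≡ Y [MOD ∏ p ∈ S, p] := ih (fun p hp => hS p (mem_insert_of_mem hp)) (fun p hp => h p (mem_insert_of_mem hp))
    exact (Nat.modEq_and_modEq_iff_modEq_mul hcop).1 ⟨h1, h2⟩

/-- Two numbers below the product of a finite set of primes with the same residues are equal. [folklore] -/
theorem eq_of_forall_mod_prime_eq {S : Finset ℕ} (hS : ∀ p ∈ S, p.Prime) {X Y : ℕ}
    (hX : X < ∏ p ∈ S, p) (hY : Y < ∏ p ∈ S, p) (h : ∀ p ∈ S, X % p = Y % p) : X = Y := by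
  have := mod_prod_eq_of_forall_mod_eq hS h
  rwa [Nat.mod_eq_of_lt hX, Nat.mod_eq_of_lt hY] at this

/-! ### Generators and discrete logarithms modulo a prime -/

section Generator

variable {p : ℕ}

/-- **The order test characterises generators**: for a prime `p` and `0 < g < p`, if
`gᵉ ≢ 1 (mod p)` for all `0 < e < p - 1`, then every `0 < a < p` is a power `gᵉ mod p` with
`e < p - 1` (the element `g` of `(ℤ/p)ˣ` has order `p - 1 = |(ℤ/p)ˣ|`). [cite: HesseAllenderBarrington2002, §4] -/
theorem exists_pow_mod_eq_of_forall_pow_ne_one (hp : p.Prime) {g : ℕ} (hg0 : 0 < g) (hgp : g < p)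
    (hord : ∀ e, 0 < e → e < p - 1 → g ^ e % p ≠ 1) {a : ℕ} (ha0 : 0 < a) (hap : a < p) :
    ∃ e < p - 1, g ^ e % p = a := by
  haveI := Fact.mk hp
  -- `g` and `a` as units of `ZMod p`
  have hgne : (g : ZMod p) ≠ 0 := by
    rw [Ne, ZMod.natCast_eq_zero_iff]
    exact fun h => absurd (Nat.le_of_dvd hg0 h) (by omega)
  have hane : (a : ZMod p) ≠ 0 := by
    rw [Ne, ZMod.natCast_eq_zero_iff]
    exact fun h => absurd (Nat.le_of_dvd ha0 h) (by omega)
  set gu : (ZMod p)ˣ := Units.mk0 _ hgne with hgu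
  set au : (ZMod p)ˣ := Units.mk0 _ hane with hau
  -- the order of `gu` is `p - 1`
  have hdvd : orderOf gu ∣ p - 1 := ZMod.orderOf_units_dvd_card_sub_one gu
  have hord' : orderOf gu = p - 1 := by
    have hpos : 0 < orderOf gu := orderOf_pos gu
    by_contra hne
    have hlt : orderOf gu < p - 1 := lt_of_le_of_ne (Nat.le_of_dvd (by have := hp.two_le; omega) hdvd) hne
    have h1 : gu ^ orderOf gu = 1 := pow_orderOf_eq_one gu
    have h2 : (g : ZMod p) ^ orderOf gu = 1 := by
      simpa only [Units.val_pow_eq_pow_val, hgu, Units.val_mk0, Units.val_one] using congrArg Units.val h1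
    apply hord (orderOf gu) hpos hlt
    have h3 : ((g ^ orderOf gu : ℕ) : ZMod p) = ((1 : ℕ) : ZMod p) := by push_cast; exact h2
    rw [ZMod.natCast_eq_natCast_iff'] at h3
    rw [h3, Nat.mod_eq_of_lt hp.one_lt]
  -- hence `gu` generates, and `au` is a power
  have hcard : orderOf gu = Fintype.card (ZMod p)ˣ := by rw [ZMod.card_units, hord']
  have hmem : au ∈ Submonoid.powers gu := by
    have hcyc := isCyclic_of_orderOf_eq_card gu (by rw [Nat.card_eq_fintype_card]; exact hcard)
    have : ∀ x : (ZMod p)ˣ, x ∈ Subgroup.zpowers gu := by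
      intro x
      have hx : x ∈ (⊤ : Subgroup (ZMod p)ˣ) := Subgroup.mem_top x
      rwa [← (Subgroup.eq_top_iff' (Subgroup.zpowers gu)).2] at hx
      intro y
      -- zpowers of an element of full order is everything
      have hsurj : Function.Surjective (fun n : Fin (orderOf gu) => gu ^ (n : ℕ)) := by
        have hinj : Function.Injective (fun n : Fin (orderOf gu) => gu ^ (n : ℕ)) :=
          fun i j hij => Fin.ext (pow_injOn_Iio_orderOf i.2 j.2 hij)
        have hbij := (Fintype.bijective_iff_injective_and_card _).2 ⟨hinj, by simp [hcard]⟩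
        exact hbij.2
      obtain ⟨n, hn⟩ := hsurj y
      exact ⟨n, by simpa using hn⟩
    exact (mem_powers_iff_mem_zpowers).2 (this au)
  obtain ⟨k, hk⟩ := (Submonoid.mem_powers_iff _ _).1 hmem
  refine ⟨k % (p - 1), Nat.mod_lt _ (by have := hp.two_le; omega), ?_⟩
  have hk' : gu ^ (k % (p - 1)) = au := by rw [← hord', pow_mod_orderOf, hk]
  have hval : ((g : ZMod p) ^ (k % (p - 1))) = (a : ZMod p) := by
    simpa only [Units.val_pow_eq_pow_val, hgu, hau, Units.val_mk0] using congrArg Units.val hk'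
  have h3 : ((g ^ (k % (p - 1)) : ℕ) : ZMod p) = ((a : ℕ) : ZMod p) := by push_cast; exact hval
  rw [ZMod.natCast_eq_natCast_iff'] at h3
  rw [h3, Nat.mod_eq_of_lt hap]

/-- **Existence of a generator passing the order test** modulo a prime `p`: some `0 < g < p` has
`gᵉ ≢ 1 (mod p)` for all `0 < e < p - 1` (the multiplicative group of `ℤ/p` is cyclic). [cite: HesseAllenderBarrington2002, §4] -/
theorem exists_generator_mod_prime (hp : p.Prime) :
    ∃ g, 0 < g ∧ g < p ∧ ∀ e, 0 < e → e < p - 1 → g ^ e % p ≠ 1 := by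
  haveI := Fact.mk hp
  obtain ⟨gu, hgu⟩ := IsCyclic.exists_monoid_generator (α := (ZMod p)ˣ)
  have hord : orderOf gu = p - 1 := by
    rw [orderOf_eq_card_of_forall_mem_powers hgu, Nat.card_eq_fintype_card, ZMod.card_units]
  refine ⟨(gu : ZMod p).val, ?_, ZMod.val_lt _, fun e he0 hep h1 => ?_⟩
  · rw [Nat.pos_iff_ne_zero, Ne, ZMod.val_eq_zero]
    exact gu.ne_zero
  · -- `gu ^ e = 1` contradicts `orderOf gu = p - 1 > e`
    have h2 : ((gu : ZMod p).val ^ e : ℕ) % p = 1 % p := by rw [h1, Nat.mod_eq_of_lt hp.one_lt]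
    have h3 : (((gu : ZMod p).val ^ e : ℕ) : ZMod p) = ((1 : ℕ) : ZMod p) :=
      (ZMod.natCast_eq_natCast_iff' _ _ _).2 h2
    push_cast at h3
    rw [ZMod.natCast_zmod_val] at h3
    have h4 : gu ^ e = 1 := Units.ext (by push_cast; exact h3)
    have h5 := orderOf_dvd_of_pow_eq_one h4
    rw [hord] at h5
    exact absurd (Nat.le_of_dvd he0 h5) (by omega)

/-- **Uniqueness of the discrete logarithm**: the powers `gᵉ mod p`, `e < p - 1`, of an element
passing the order test are pairwise distinct. [cite: HesseAllenderBarrington2002, §4] -/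
theorem pow_mod_injOn (hp : p.Prime) {g : ℕ} (hg0 : 0 < g) (hgp : g < p)
    (hord : ∀ e, 0 < e → e < p - 1 → g ^ e % p ≠ 1) {e₁ e₂ : ℕ} (h₁ : e₁ < p - 1) (h₂ : e₂ < p - 1)
    (h : g ^ e₁ % p = g ^ e₂ % p) : e₁ = e₂ := by
  haveI := Fact.mk hp
  -- reduce to `g^{|e₁ - e₂|} ≡ 1`
  wlog hle : e₁ ≤ e₂ generalizing e₁ e₂
  · exact (this h₂ h₁ h.symm (by omega)).symm
  obtain ⟨d, rfl⟩ := Nat.exists_eq_add_of_le hle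
  rcases Nat.eq_zero_or_pos d with rfl | hd
  · rfl
  · exfalso
    apply hord d hd (by omega)
    have hgne : (g : ZMod p) ≠ 0 := by
      rw [Ne, ZMod.natCast_eq_zero_iff]
      exact fun h' => absurd (Nat.le_of_dvd hg0 h') (by omega)
    have hc : ((g ^ e₁ : ℕ) : ZMod p) = ((g ^ (e₁ + d) : ℕ) : ZMod p) := (ZMod.natCast_eq_natCast_iff' _ _ _).2 h
    push_cast at hc
    rw [pow_add] at hc
    have hd1 : (g : ZMod p) ^ d = 1 := by
      have hne : (g : ZMod p) ^ e₁ ≠ 0 := pow_ne_zero _ hgne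
      calc (g : ZMod p) ^ d = ((g : ZMod p) ^ e₁)⁻¹ * ((g : ZMod p) ^ e₁ * (g : ZMod p) ^ d) := by
            rw [← mul_assoc, inv_mul_cancel₀ hne, one_mul]
        _ = ((g : ZMod p) ^ e₁)⁻¹ * (g : ZMod p) ^ e₁ := by rw [← hc]
        _ = 1 := inv_mul_cancel₀ hne
    have h3 : ((g ^ d : ℕ) : ZMod p) = ((1 : ℕ) : ZMod p) := by push_cast; exact hd1
    rw [ZMod.natCast_eq_natCast_iff'] at h3
    rw [h3, Nat.mod_eq_of_lt hp.one_lt]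

/-- `g^{p-1} ≡ 1 (mod p)` for `0 < g < p` (Fermat). [folklore] -/
theorem pow_sub_one_mod_prime (hp : p.Prime) {g : ℕ} (hg0 : 0 < g) (hgp : g < p) : g ^ (p - 1) % p = 1 := by
  haveI := Fact.mk hp
  have hgne : (g : ZMod p) ≠ 0 := by
    rw [Ne, ZMod.natCast_eq_zero_iff]
    exact fun h' => absurd (Nat.le_of_dvd hg0 h') (by omega)
  have h1 : (g : ZMod p) ^ (p - 1) = 1 := ZMod.pow_card_sub_one_eq_one hgne
  have h3 : ((g ^ (p - 1) : ℕ) : ZMod p) = ((1 : ℕ) : ZMod p) := by push_cast; exact h1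
  rw [ZMod.natCast_eq_natCast_iff'] at h3
  rw [h3, Nat.mod_eq_of_lt hp.one_lt]

/-- Powers of `g` modulo `p` only depend on the exponent modulo `p - 1`. [folklore] -/
theorem pow_mod_prime_eq_pow_mod (hp : p.Prime) {g : ℕ} (hg0 : 0 < g) (hgp : g < p) (E : ℕ) :
    g ^ E % p = g ^ (E % (p - 1)) % p := by
  conv_lhs => rw [← Nat.div_add_mod E (p - 1), pow_add, pow_mul, Nat.mul_mod, Nat.pow_mod,
    pow_sub_one_mod_prime hp hg0 hgp, one_pow, Nat.one_mod_eq_one.2 hp.one_lt.ne', one_mul, Nat.mod_mod]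

/-- **Iterated product from discrete logarithms** (HAB §4, Step 2): if no `aᵢ` is divisible by the
prime `p` and `g^{eᵢ} ≡ aᵢ (mod p)`, then `∏ aᵢ ≡ g^{(∑ eᵢ) mod (p-1)} (mod p)`. [cite: HesseAllenderBarrington2002, §4] -/
theorem prod_mod_prime_eq_pow_sum_dlog {ι : Type*} (s : Finset ι) (hp : p.Prime) {g : ℕ} (hg0 : 0 < g) (hgp : g < p)
    (a e : ι → ℕ) (he : ∀ i ∈ s, g ^ e i % p = a i % p) :
    (∏ i ∈ s, a i) % p = g ^ ((∑ i ∈ s, e i) % (p - 1)) % p := by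
  classical
  rw [← pow_mod_prime_eq_pow_mod hp hg0 hgp]
  induction s using Finset.induction_on with
  | empty => simp
  | insert j s hj ih =>
    rw [prod_insert hj, sum_insert hj, pow_add, Nat.mul_mod, Nat.mul_mod (g ^ e j),
      ih (fun i hi => he i (mem_insert_of_mem hi)), he j (mem_insert_self j s)]

/-- A product over a finite set has a factor divisible by the prime `p` iff it is `≡ 0`. [folklore] -/
theorem prod_mod_prime_eq_zero_iff {ι : Type*} (s : Finset ι) (hp : p.Prime) (a : ι → ℕ) :
    (∏ i ∈ s, a i) % p = 0 ↔ ∃ i ∈ s, a i % p = 0 := by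
  simp only [← Nat.dvd_iff_mod_eq_zero]
  exact Prime.dvd_finsetProd_iff hp.prime a

end Generator

end Literature.Computability.Complexity
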